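import Mathlib.Analysis.Convex.Basic
import Mathlib.Analysis.SpecialFunctions.Pow.Real
import HarnessLib

/-!
# The open slice hexagon lies in any convex set containing its six vertices (helper for stub
# `stub_sliceDomination` of the crux `StackingLiminf`, stmt-Ventures-19145, line `LayerChain`)

Route `StickyWulffConstant` of the venture `Summits/Ventures/Crystal3D` (cell `crystal3d-full`).

The slice hexagon `α Δ + β (−Δ)` (`Δ = conv{ℓ₁, ℓ₂, ℓ₃}` the unit triangle of the hexagonal frame) has
the six vertices `(±α/2, (α+2β)√3/6)`, `(±(α+β)/2, (α−β)√3/6)`, `(±β/2, −(2α+β)√3/6)`; in fibred form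
its interior is `lo < x₂ < hi`, `|x₁| < U(x₂)` with `lo = −(2α+β)√3/6`, `hi = (α+2β)√3/6`,
`U(w) = min((2α+β)/3 − w√3/3, (α+2β)/3 + w√3/3)`.  We prove: a CONVEX set containing the six vertices
contains the open fibred hexagon (`sliceHexagon_open_subset_of_convex`; elementary: every point lies on
the horizontal chord between two boundary points, each a convex combination of two vertices).  Used with
`S` = a section of the stacking Wulff body `W_f` and the vertices certified by zonotope certificates.
WHAT THIS IS NOT: anything about `W_f` itself; rung F-C1 not moved.
-/

noncomputable section

namespace Summit.Ventures.Crystal3D.Theorems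

open Set

/-- Chord lemma: if `L = (-u, w)` and `R = (u, w)` (`u > 0`) lie in a convex set `S`, then so does
every `(x, w)` with `|x| ≤ u`. -/
theorem mem_of_convex_of_chord (S : Set (ℝ × ℝ)) (hS : Convex ℝ S) (u w x : ℝ) (hu : 0 < u)
    (hL : (-u, w) ∈ S) (hR : (u, w) ∈ S) (hxl : -u ≤ x) (hxu : x ≤ u) : (x, w) ∈ S := by
  obtain ⟨mu, hmu⟩ : ∃ mu : ℝ, mu = (u - x) / (2 * u) := ⟨_, rfl⟩
  have hmu0 : 0 ≤ mu := by rw [hmu]; exact div_nonneg (by linarith) (by linarith)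
  have hmu1 : mu ≤ 1 := by rw [hmu]; exact (div_le_one (by linarith)).2 (by linarith)
  have hmux : mu * (2 * u) = u - x := by rw [hmu]; exact div_mul_cancel₀ _ (by linarith)
  have hp := hS hL hR hmu0 (by linarith : 0 ≤ 1 - mu) (by ring)
  convert hp using 1
  ext
  · simp only [Prod.fst_add, Prod.smul_fst, smul_eq_mul]; linarith
  · simp only [Prod.snd_add, Prod.smul_snd, smul_eq_mul]; ring

/-- Edge lemma: a point dividing the segment between two points of a convex set in ratio `lam ∈ [0,1]`
lies in the set (coordinates written out). -/
theorem mem_of_convex_of_edge (S : Set (ℝ × ℝ)) (hS : Convex ℝ S) (a₁ a₂ b₁ b₂ lam : ℝ)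
    (ha : (a₁, a₂) ∈ S) (hb : (b₁, b₂) ∈ S) (h0 : 0 ≤ lam) (h1 : lam ≤ 1) :
    ((1 - lam) * a₁ + lam * b₁, (1 - lam) * a₂ + lam * b₂) ∈ S := by
  have hp := hS ha hb (by linarith : 0 ≤ 1 - lam) h0 (by ring)
  convert hp using 1
  ext <;> simp only [Prod.fst_add, Prod.snd_add, Prod.smul_fst, Prod.smul_snd, smul_eq_mul]

/-- A convex set `S ⊆ ℝ²` containing the six vertices of the slice hexagon `α Δ + β (−Δ)` contains the
whole open hexagon (fibred form; for `α` or `β ≤ 0` the statement is about whatever the fibred set is). -/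
theorem sliceHexagon_open_subset_of_convex (S : Set (ℝ × ℝ)) (hS : Convex ℝ S) (α β : ℝ)
    (h1 : (α / 2, (α + 2 * β) * Real.sqrt 3 / 6) ∈ S)
    (h2 : (-(α / 2), (α + 2 * β) * Real.sqrt 3 / 6) ∈ S)
    (h3 : ((α + β) / 2, (α - β) * Real.sqrt 3 / 6) ∈ S)
    (h4 : (-((α + β) / 2), (α - β) * Real.sqrt 3 / 6) ∈ S)
    (h5 : (β / 2, -((2 * α + β) * Real.sqrt 3 / 6)) ∈ S)
    (h6 : (-(β / 2), -((2 * α + β) * Real.sqrt 3 / 6)) ∈ S) :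
    {p : ℝ × ℝ | -((2 * α + β) * Real.sqrt 3 / 6) < p.2 ∧ p.2 < (α + 2 * β) * Real.sqrt 3 / 6 ∧
        -min ((2 * α + β) / 3 - p.2 * Real.sqrt 3 / 3) ((α + 2 * β) / 3 + p.2 * Real.sqrt 3 / 3) < p.1 ∧
        p.1 < min ((2 * α + β) / 3 - p.2 * Real.sqrt 3 / 3) ((α + 2 * β) / 3 + p.2 * Real.sqrt 3 / 3)}
      ⊆ S := by
  set s3 := Real.sqrt 3 with hs3
  have h33 : s3 * s3 = 3 := Real.mul_self_sqrt (by norm_num)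
  have hs3pos : 0 < s3 := Real.sqrt_pos.2 (by norm_num)
  rintro ⟨x, w⟩ ⟨hlo, hhi, hxl, hxu⟩
  simp only at hlo hhi hxl hxu
  -- the two branches of the half-width
  have hU1 : min ((2 * α + β) / 3 - w * s3 / 3) ((α + 2 * β) / 3 + w * s3 / 3) ≤
      (2 * α + β) / 3 - w * s3 / 3 := min_le_left _ _
  have hU2 : min ((2 * α + β) / 3 - w * s3 / 3) ((α + 2 * β) / 3 + w * s3 / 3) ≤
      (α + 2 * β) / 3 + w * s3 / 3 := min_le_right _ _
  have hxpos : -min ((2 * α + β) / 3 - w * s3 / 3) ((α + 2 * β) / 3 + w * s3 / 3) <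
      min ((2 * α + β) / 3 - w * s3 / 3) ((α + 2 * β) / 3 + w * s3 / 3) := lt_trans hxl hxu
  rcases le_or_gt ((α - β) * s3 / 6) w with hcase | hcase
  · -- upper part (`w ≥ w*`): chord between the edges V4–V2 and V3–V1
    have hden : 0 < (α + 2 * β) * s3 / 6 - (α - β) * s3 / 6 := by nlinarith
    obtain ⟨lam, hlam⟩ : ∃ lam : ℝ,
        lam = (w - (α - β) * s3 / 6) / ((α + 2 * β) * s3 / 6 - (α - β) * s3 / 6) := ⟨_, rfl⟩
    have hlam0 : 0 ≤ lam := by rw [hlam]; exact div_nonneg (by linarith) hden.le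
    have hlam1 : lam ≤ 1 := by rw [hlam]; exact (div_le_one hden).2 (by linarith)
    have hlamw : lam * ((α + 2 * β) * s3 / 6 - (α - β) * s3 / 6) = w - (α - β) * s3 / 6 := by
      rw [hlam]; exact div_mul_cancel₀ _ hden.ne'
    have hw : (1 - lam) * ((α - β) * s3 / 6) + lam * ((α + 2 * β) * s3 / 6) = w := by
      linear_combination hlamw
    -- the boundary points on the two edges
    have hR := mem_of_convex_of_edge S hS _ _ _ _ lam h3 h1 hlam0 hlam1
    have hL := mem_of_convex_of_edge S hS _ _ _ _ lam h4 h2 hlam0 hlam1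
    rw [hw] at hR hL
    -- the common half-width `u` of the chord is the first branch of `U`
    have hu_eq : (1 - lam) * ((α + β) / 2) + lam * (α / 2) = (2 * α + β) / 3 - w * s3 / 3 := by
      rw [← hw]
      linear_combination ((α - β) / 18 + lam * β / 6) * h33
    have hL' : (-((1 - lam) * ((α + β) / 2) + lam * (α / 2)), w) ∈ S := by
      convert hL using 2; ring
    refine mem_of_convex_of_chord S hS _ w x ?_ hL' hR ?_ ?_
    · rw [hu_eq]; linarith
    · rw [hu_eq]; linarith
    · rw [hu_eq]; linarith
  · -- lower part (`w < w*`): chord between the edges V6–V4 and V5–V3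
    have hden : 0 < (α - β) * s3 / 6 - -((2 * α + β) * s3 / 6) := by nlinarith
    obtain ⟨lam, hlam⟩ : ∃ lam : ℝ,
        lam = (w - -((2 * α + β) * s3 / 6)) / ((α - β) * s3 / 6 - -((2 * α + β) * s3 / 6)) :=
      ⟨_, rfl⟩
    have hlam0 : 0 ≤ lam := by rw [hlam]; exact div_nonneg (by linarith) hden.le
    have hlam1 : lam ≤ 1 := by rw [hlam]; exact (div_le_one hden).2 (by linarith)
    have hlamw : lam * ((α - β) * s3 / 6 - -((2 * α + β) * s3 / 6)) =
        w - -((2 * α + β) * s3 / 6) := by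
      rw [hlam]; exact div_mul_cancel₀ _ hden.ne'
    have hw : (1 - lam) * -((2 * α + β) * s3 / 6) + lam * ((α - β) * s3 / 6) = w := by
      linear_combination hlamw
    have hR := mem_of_convex_of_edge S hS _ _ _ _ lam h5 h3 hlam0 hlam1
    have hL := mem_of_convex_of_edge S hS _ _ _ _ lam h6 h4 hlam0 hlam1
    rw [hw] at hR hL
    have hu_eq : (1 - lam) * (β / 2) + lam * ((α + β) / 2) = (α + 2 * β) / 3 + w * s3 / 3 := by
      rw [← hw]
      linear_combination ((2 * α + β) / 18 - lam * α / 6) * h33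
    have hL' : (-((1 - lam) * (β / 2) + lam * ((α + β) / 2)), w) ∈ S := by
      convert hL using 2; ring
    refine mem_of_convex_of_chord S hS _ w x ?_ hL' hR ?_ ?_
    · rw [hu_eq]; linarith
    · rw [hu_eq]; linarith
    · rw [hu_eq]; linarith

end Summit.Ventures.Crystal3D.Theorems
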